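import Mathlib.NumberTheory.LegendreSymbol.JacobiSymbol
import Summits.BirchSwinnertonDyer.BirchSwinnertonDyer.Theorems.BiquadraticEisensteinDescentHeegnerTwistCouplingInSupplyThreeSquaresPinDual
import Summits.BirchSwinnertonDyer.BirchSwinnertonDyer.Theorems.BiquadraticEisensteinDescentHeegnerTwistCouplingInSupplyMonskyCells
import HarnessLib

set_option linter.dupNamespace false -- `Summit.BirchSwinnertonDyer.BirchSwinnertonDyer.Theorems.…` (summit = sub)
set_option autoImplicit false

/-!
# Crux `HeegnerTwistCouplingInSupply` (stmt-BirchSwinnertonDyer-21381) — INDEFINITE pins: auxiliary primes of the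
# types `(3,+)` (every `p ≡ 3 (mod 4)`) and `(3,−)` (every `p ≡ 3 (mod 8)`) of size `O(p)`, with no representation count

Route `BiquadraticEisensteinDescent` (cell `pub/bsd-wall`, row-12 line lead `bsd-line-ibd-p1` g11). Companion of the g10
files `…ThreeSquaresPin` (p642610: the `(5,−)`-pin `ℓ < 2p` from `2p = x² + y² + z²`) and `…ThreeSquaresPinDual`
(p643125: the `(3,−)`-pin `ℓ′ < p` from `p = u² + 2v² + w²`, for `p ≡ 7 (mod 8)` only — at `p ≡ 3 (mod 8)` that pin
needs a NON-degenerate representation, i.e. Gauss's count `r₃(2p) = 12·h(−8p) > 24`, not in the tree). Notation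
(card `three-squares-heegner-pin`): an auxiliary prime `q` has TYPE `(c, ε)` if `q ≡ c (mod 8)` and `(q/p) = ε`.
The card pins `(5,−)` and `(3,−)` by POSITIVE DEFINITE ternary forms and records `(3,+)` as "2-adically unpinnable";
the definite pin is `< p` or `< 2p` for free but needs an existence theorem for the representation.

THIS FILE: the same arithmetic with the INDEFINITE isotropic forms `u² + 2v² − z²` and `u² + 2v² − 2w²`, which
represent `p` by an explicit one-parameter family of integer points — so NO three-square / class-number input is
needed, non-degeneracy is arranged by hand, and the pinned prime is bounded by choosing the parameter near a square
root:

* §2 `(3,+)` for EVERY prime `p ≡ 3 (mod 4)`, `p ≥ 7` (`exists_indefinite_certificate_threePlus`): with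
  `X = (p−1)/2` (odd) and any odd `v`, `e := |v² − X|`, `u := e ∓ 1`: `u² + 2v² = p + e²` with `u, v` odd, so
  `B := p + e² ≡ 3 (mod 8)` has a prime factor `q ≡ 3 (mod 8)` (tree `exists_prime_dvd_mod_eight_eq_three`);
  `e² ≡ −p (mod q)` with `q ∤ e` (as `0 < e < p`) gives `(−p/q) = +1`, `(p/q) = −1`, and reciprocity at two primes
  `≡ 3 (mod 4)` gives `(q/p) = +1`. Choosing `v` the odd integer nearest `√X` (or the next one when `X` is itself an
  odd square) gives `e ≤ 2√X + 2` (resp. `≤ 4√X + 4`), hence `q ≤ B ≤ 10p` for `p ≥ 800` (`indefinitePinThreePlus`;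
  in fact `B < 3p` off the thin family `p = 2v² + 1`).
* §3 `(3,−)` for EVERY prime `p ≡ 3 (mod 8)` (`exists_indefinite_certificate_threeMinus`): with `u` odd,
  `u² ≥ p + 6`, `v := (u² − p − 2)/4` (odd), `w := v + 1`: `u² + 2v² = p + 2w²`, `B ≡ 3 (mod 8)`, a prime factor
  `q ≡ 3 (mod 8)` has `2w² ≡ −p (mod q)`, `(2/q) = −1` ⇒ `(−p/q) = −1` ⇒ `(p/q) = +1` ⇒ `(q/p) = −1`; with `u` the least
  such odd number, `q ≤ B ≤ 4p` for `p ≥ 200` (`indefinitePinThreeMinus_of_mod_eight_eq_three`). (For `p ≡ 7 (mod 8)`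
  this shape is impossible — `p + 2w² ≢ 3 (mod 8)` — and the definite pin of p643125 applies instead.)

Consumers (next files of this line lead): with the partner prime `5` — type `(5,−)` iff `p ≡ ±2 (mod 5)`, type `(5,+)`
iff `p ≡ ±1 (mod 5)` — the Rédei-robust Monsky cells A `{(3,+),(5,−)}`, B `{(3,−),(5,+)}` (even matrix, `E_{2p}`) and
the row-1 cell (odd matrix, `E_p`, `p ≡ 7 (mod 8)`) of p643875 close with the Heegner field `K′ = ℚ(√−5q)`,
`|d_{K′}| = 5q = O(p)`, whose class number is `< p` by the tree's class-number-formula bound — extending the g10 corner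
theorems (`p ≡ 11 (mod 12)`, `p ≡ 23 (mod 24)`, `p ≡ 7 (mod 8) ∧ ±1 (mod 5)`) to EVERY prime `p ≡ 3 (mod 4)` for
`W = E_{2p}` and to `p ≡ ±2 (mod 5)` for `W = E_p`. THEOREMS ONLY (elementary number theory); nothing about the crux
(all CM `W`), `L`-values, class numbers or any case of BSD is asserted here. Supports stmt-BirchSwinnertonDyer-21381.
-/

namespace Summit.BirchSwinnertonDyer.BirchSwinnertonDyer.Theorems.BiquadraticEisensteinDescentHeegnerTwistCouplingInSupplyIndefinitePin

open Literature.NumberTheory.EllipticCurves Literature.NumberTheory.EllipticCurves.HeathBrown1994.Families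
open Summit.BirchSwinnertonDyer.BirchSwinnertonDyer.Theorems.BiquadraticEisensteinDescentHeegnerTwistCouplingInSupplyThreeSquaresPin
  Summit.BirchSwinnertonDyer.BirchSwinnertonDyer.Theorems.BiquadraticEisensteinDescentHeegnerTwistCouplingInSupplyThreeSquaresPinDual

/-! ## §1 Symbol lemmas: reading `(q/p)` off a congruence `c·t² ≡ −p (mod q)` -/

/-- For primes `p, q ≡ 3 (mod 4)`, `q ∤ t`, and `t² ≡ −p (mod q)`: `(q/p) = +1` (type `(·,+)`).
(`(−p/q) = (t²/q) = 1`, `(−1/q) = −1` ⇒ `(p/q) = −1` ⇒ reciprocity.) [folklore] -/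
theorem jacobiSym_eq_one_of_sq_add_dvd {p q t : ℕ} (hq : q.Prime) (hp4 : p % 4 = 3) (hq4 : q % 4 = 3)
    (hqt : ¬ q ∣ t) (hdvd : q ∣ p + t ^ 2) : jacobiSym (q : ℤ) p = 1 := by
  have hgcd : (t : ℤ).gcd q = 1 := by
    rw [Int.gcd_natCast_natCast]
    exact (Nat.coprime_comm.mp ((Nat.Prime.coprime_iff_not_dvd hq).mpr hqt))
  have hsq : jacobiSym ((t : ℤ) ^ 2) q = 1 := jacobiSym.sq_one' hgcd
  have hmod : (-(p : ℤ)) % (q : ℤ) = ((t : ℤ) ^ 2) % (q : ℤ) := by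
    rw [Int.emod_eq_emod_iff_emod_sub_eq_zero]
    have : (-(p : ℤ)) - (t : ℤ) ^ 2 = -((p + t ^ 2 : ℕ) : ℤ) := by push_cast; ring
    rw [this]
    exact Int.emod_eq_zero_of_dvd ((dvd_neg).mpr (Int.natCast_dvd_natCast.mpr hdvd))
  have hnegp : jacobiSym (-(p : ℤ)) q = 1 := by rw [jacobiSym.mod_left' hmod, hsq]
  have hm1 : jacobiSym (-1) q = -1 := DeuringLadic.jacobiSym_neg_one_of_mod_four hq4
  have hpq : jacobiSym (p : ℤ) q = -1 := by
    have : (-(p : ℤ)) = (-1) * (p : ℤ) := by ring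
    rw [this, jacobiSym.mul_left, hm1] at hnegp
    linarith
  rw [jacobiSym.quadratic_reciprocity_three_mod_four hq4 hp4, hpq]
  norm_num

/-- For primes `p ≡ 3 (mod 4)`, `q ≡ 3 (mod 8)`, `q ∤ t`, and `2t² ≡ −p (mod q)`: `(q/p) = −1` (type `(3,−)`).
(`(−p/q) = (2/q)(t²/q) = −1`, `(−1/q) = −1` ⇒ `(p/q) = +1` ⇒ reciprocity.) [folklore] -/
theorem jacobiSym_eq_neg_one_of_two_mul_sq_add_dvd {p q t : ℕ} (hq : q.Prime) (hp4 : p % 4 = 3) (hq8 : q % 8 = 3)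
    (hqt : ¬ q ∣ t) (hdvd : q ∣ p + 2 * t ^ 2) : jacobiSym (q : ℤ) p = -1 := by
  have hgcd : (t : ℤ).gcd q = 1 := by
    rw [Int.gcd_natCast_natCast]
    exact (Nat.coprime_comm.mp ((Nat.Prime.coprime_iff_not_dvd hq).mpr hqt))
  have hsq : jacobiSym ((t : ℤ) ^ 2) q = 1 := jacobiSym.sq_one' hgcd
  have h2 : jacobiSym 2 q = -1 := jacobiSym_two_eq_neg_one (Or.inl hq8)
  have hmod : (-(p : ℤ)) % (q : ℤ) = (2 * (t : ℤ) ^ 2) % (q : ℤ) := by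
    rw [Int.emod_eq_emod_iff_emod_sub_eq_zero]
    have : (-(p : ℤ)) - 2 * (t : ℤ) ^ 2 = -((p + 2 * t ^ 2 : ℕ) : ℤ) := by push_cast; ring
    rw [this]
    exact Int.emod_eq_zero_of_dvd ((dvd_neg).mpr (Int.natCast_dvd_natCast.mpr hdvd))
  have hnegp : jacobiSym (-(p : ℤ)) q = -1 := by
    rw [jacobiSym.mod_left' hmod, jacobiSym.mul_left, h2, hsq]
    norm_num
  have hm1 : jacobiSym (-1) q = -1 := DeuringLadic.jacobiSym_neg_one_of_mod_four (by omega)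
  have hpq : jacobiSym (p : ℤ) q = 1 := by
    have : (-(p : ℤ)) = (-1) * (p : ℤ) := by ring
    rw [this, jacobiSym.mul_left, hm1] at hnegp
    linarith
  rw [jacobiSym.quadratic_reciprocity_three_mod_four (by omega) hp4, hpq]

/-! ## §2 The `(3,+)` pin from `u² + 2v² − e² = p` -/

/-- **The `(3,+)` certificate.** For a prime `p ≡ 3 (mod 4)`, `p ≥ 7`, with `X = (p−1)/2 = p/2` and `r = ⌊√X⌋`:
there are `u v e q : ℕ` with `u² + 2v² = p + e²`, `u, v` odd, `0 < e < p`, `q` a prime `≡ 3 (mod 8)` dividing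
`p + e²`, `(q/p) = +1`; and `e ≤ 4r + 4`, indeed `e ≤ 2r + 2` unless `X = r²` (the family `p = 2r² + 1`).
Construction: `v ∈ {o, o+2}` for the odd `o ∈ {r−1, r}`, `e = |v² − X|`, `u = e ∓ 1`. [folklore] -/
theorem exists_indefinite_certificate_threePlus {p : ℕ} (hp : p.Prime) (hp4 : p % 4 = 3) (h7 : 7 ≤ p) :
    ∃ u v e q : ℕ, u ^ 2 + 2 * v ^ 2 = p + e ^ 2 ∧ u % 2 = 1 ∧ v % 2 = 1 ∧ 0 < e ∧ e < p ∧
      q.Prime ∧ q ∣ p + e ^ 2 ∧ q % 8 = 3 ∧ jacobiSym (q : ℤ) p = 1 ∧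
      e ≤ 4 * Nat.sqrt (p / 2) + 4 ∧ (Nat.sqrt (p / 2) * Nat.sqrt (p / 2) ≠ p / 2 → e ≤ 2 * Nat.sqrt (p / 2) + 2) := by
  -- `X = p / 2` is odd and `2X + 1 = p`; `r = ⌊√X⌋ ≥ 1`
  obtain ⟨X, hX⟩ : ∃ X, X = p / 2 := ⟨_, rfl⟩
  have hpX : p = 2 * X + 1 := by omega
  have hXodd : X % 2 = 1 := by omega
  obtain ⟨r, hr⟩ : ∃ r, r = Nat.sqrt X := ⟨_, rfl⟩
  have hrr : r * r ≤ X := hr ▸ Nat.sqrt_le X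
  have hXr : X < (r + 1) * (r + 1) := hr ▸ Nat.lt_succ_sqrt X
  have hr1 : 1 ≤ r := by
    by_contra h0
    have h00 : r = 0 := by omega
    rw [h00] at hXr
    omega
  rw [← hX, ← hr]
  -- the odd number `o ∈ {r - 1, r}`
  obtain ⟨o, ho2, hor, hro⟩ : ∃ o : ℕ, o % 2 = 1 ∧ o ≤ r ∧ r ≤ o + 1 := by
    by_cases hodd : r % 2 = 1
    · exact ⟨r, hodd, le_rfl, by omega⟩
    · exact ⟨r - 1, by omega, by omega, by omega⟩
  have hoo : o * o ≤ X := (Nat.mul_le_mul hor hor).trans hrr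
  have hXo : X < (o + 2) * (o + 2) := hXr.trans_le (Nat.mul_le_mul (by omega) (by omega))
  -- the two candidate distances `dm = X - o²`, `dp = (o+2)² - X`, `dm + dp = 4o + 4`
  obtain ⟨dm, hdm⟩ : ∃ dm : ℕ, dm + o * o = X := ⟨X - o * o, Nat.sub_add_cancel hoo⟩
  obtain ⟨dp, hdp⟩ : ∃ dp : ℕ, dp + X = o * o + 4 * o + 4 :=
    ⟨(o + 2) * (o + 2) - X, by have := Nat.sub_add_cancel hXo.le; nlinarith [this]⟩
  have hsum : dm + dp = 4 * o + 4 := by linarith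
  have hexp : (o + 2) * (o + 2) = o * o + 4 * o + 4 := by ring
  have hdp0 : 0 < dp := by linarith
  -- parity: `o²` odd, `X` odd ⇒ `dm`, `dp` even
  have hoosq : (o * o) % 2 = 1 := by
    rw [Nat.mul_mod, ho2]
  have hdm2 : dm % 2 = 0 := by omega
  have hdp2 : dp % 2 = 0 := by omega
  -- `2r + 2 < p`
  have h2r : 2 * r + 2 < p := by
    rcases Nat.lt_or_ge r 3 with hr3 | hr3
    · omega
    · nlinarith [hrr]
  -- the choice of `(u, v, e)`
  obtain ⟨u, v, e, hid, hu, hv, he0, hele, hesmall⟩ : ∃ u v e : ℕ, u ^ 2 + 2 * v ^ 2 = p + e ^ 2 ∧ u % 2 = 1 ∧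
      v % 2 = 1 ∧ 0 < e ∧ e ≤ 4 * o + 4 ∧ (o * o ≠ X → e ≤ 2 * o + 2) := by
    have ho22 : (o + 2) % 2 = 1 := by clear * - ho2; omega
    by_cases hsq : dm = 0
    · -- `X = o²`: take `v = o + 2`, `e = dp = 4o + 4`, `u = dp - 1`
      obtain ⟨d1, rfl⟩ : ∃ d1, dp = d1 + 1 := ⟨dp - 1, by clear * - hdp0; omega⟩
      have hd1 : d1 % 2 = 1 := by clear * - hdp2; omega
      have hele : d1 + 1 ≤ 4 * o + 4 := by clear * - hsum; omega
      have hooX : o * o = X := by clear * - hdm hsq; omega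
      refine ⟨d1, o + 2, d1 + 1, ?_, hd1, ho22, Nat.succ_pos d1, hele, fun hne => absurd hooX hne⟩
      have h2 : (o + 2) ^ 2 = d1 + 1 + X := by rw [sq, hexp]; clear * - hdp; omega
      rw [h2, hpX]
      ring
    · by_cases hle : dm ≤ dp
      · -- take `v = o`, `e = dm`, `u = dm + 1`
        have hu1 : (dm + 1) % 2 = 1 := by clear * - hdm2; omega
        have hdm0 : 0 < dm := by clear * - hsq; omega
        have hele : dm ≤ 4 * o + 4 := by clear * - hsum; omega
        have hes : o * o ≠ X → dm ≤ 2 * o + 2 := fun _ => by clear * - hsum hle; omega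
        refine ⟨dm + 1, o, dm, ?_, hu1, ho2, hdm0, hele, hes⟩
        have hX' : X = dm + o ^ 2 := by rw [sq]; clear * - hdm; omega
        rw [hpX, hX']
        ring
      · -- take `v = o + 2`, `e = dp`, `u = dp - 1`
        obtain ⟨d1, rfl⟩ : ∃ d1, dp = d1 + 1 := ⟨dp - 1, by clear * - hdp0; omega⟩
        have hd1 : d1 % 2 = 1 := by clear * - hdp2; omega
        have hele : d1 + 1 ≤ 4 * o + 4 := by clear * - hsum; omega
        have hes : o * o ≠ X → d1 + 1 ≤ 2 * o + 2 := fun _ => by clear * - hsum hle; omega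
        refine ⟨d1, o + 2, d1 + 1, ?_, hd1, ho22, Nat.succ_pos d1, hele, hes⟩
        have h2 : (o + 2) ^ 2 = d1 + 1 + X := by rw [sq, hexp]; clear * - hdp; omega
        rw [h2, hpX]
        ring
  -- `e < p`
  have hX3 : 3 ≤ X := by clear * - hpX h7; omega
  have hep : e < p := by
    by_cases hsqX : o * o = X
    · -- square case: `X = o²` odd with `X ≥ 3` forces `o ≥ 3`, and `p = 2o² + 1 > 4o + 4`
      have ho3 : 3 ≤ o := by
        by_contra h
        have ho1 : o ≤ 1 := by clear * - h ho2; omega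
        have hoo1 : o * o ≤ 1 := Nat.mul_le_mul ho1 ho1
        clear * - hoo1 hsqX hX3
        omega
      clear * - hele hsqX hpX ho3
      nlinarith
    · have h1 := hesmall hsqX
      clear * - h1 h2r hor
      omega
  -- `B ≡ 3 (mod 8)` and its prime factor `q ≡ 3 (mod 8)`
  have hu8 : u ^ 2 % 8 = 1 := sq_mod_eight_of_odd hu
  have hv8 : v ^ 2 % 8 = 1 := sq_mod_eight_of_odd hv
  have hB3 : (u ^ 2 + 2 * v ^ 2) % 8 = 3 := by clear * - hu8 hv8; omega
  obtain ⟨q, hq, hqB, hq8⟩ := exists_prime_dvd_mod_eight_eq_three (m := u ^ 2 + 2 * v ^ 2) rfl hB3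
  rw [hid] at hqB
  have hq4 : q % 4 = 3 := by clear * - hq8; omega
  -- `q ∤ e`: otherwise `q ∣ p`, `q = p`, `p ∣ e` with `0 < e < p`
  have hqe : ¬ q ∣ e := by
    intro hqe'
    have hqp : q ∣ p := by
      have h1 : q ∣ e ^ 2 := Dvd.dvd.pow hqe' two_ne_zero
      exact (Nat.dvd_add_left h1).mp hqB
    have hqp' : q = p := (Nat.prime_dvd_prime_iff_eq hq hp).mp hqp
    rw [hqp'] at hqe'
    have hle : p ≤ e := Nat.le_of_dvd he0 hqe'
    clear * - hle hep
    omega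
  refine ⟨u, v, e, q, hid, hu, hv, he0, hep, hq, hqB, hq8,
    jacobiSym_eq_one_of_sq_add_dvd hq hp4 hq4 hqe hqB, ?_, fun hne => ?_⟩
  · clear * - hele hor
    omega
  · have hne' : o * o ≠ X := by
      intro hoX
      apply hne
      -- `o² = X`, `o ≤ r`, `r² ≤ X` ⇒ `r = o`
      have hro' : r ≤ o := by
        by_contra h
        have h1 : o + 1 ≤ r := by clear * - h; omega
        have h2 := Nat.mul_le_mul h1 h1
        clear * - h2 hrr hoX
        nlinarith
      have hre : r = o := le_antisymm hro' hor
      rw [hre, hoX]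
    have h1 := hesmall hne'
    clear * - h1 hor
    omega

/-- **The `(3,+)` pin, sized** (consumer form): for a prime `p ≡ 3 (mod 4)` with `p ≥ 800` there is a prime
`q ≡ 3 (mod 8)` with `(q/p) = +1` and `q ≤ 10p` (indeed `q ≤ p + e²` with `e ≤ 2√(p/2) + 2`, resp. `4√(p/2) + 4` on the
family `p = 2r² + 1`). [folklore] -/
theorem indefinitePinThreePlus {p : ℕ} (hp : p.Prime) (hp4 : p % 4 = 3) (h800 : 800 ≤ p) :
    ∃ q : ℕ, q.Prime ∧ q % 8 = 3 ∧ jacobiSym (q : ℤ) p = 1 ∧ q ≤ 10 * p := by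
  obtain ⟨u, v, e, q, hid, -, -, he0, -, hq, hqB, hq8, hJ, hele, hesmall⟩ :=
    exists_indefinite_certificate_threePlus hp hp4 (by omega)
  refine ⟨q, hq, hq8, hJ, (Nat.le_of_dvd (by positivity) hqB).trans ?_⟩
  obtain ⟨r, hr⟩ : ∃ r, r = Nat.sqrt (p / 2) := ⟨_, rfl⟩
  rw [← hr] at hele hesmall
  have hrr : r * r ≤ p / 2 := hr ▸ Nat.sqrt_le (p / 2)
  have hX2 : 2 * (p / 2) ≤ p := Nat.mul_div_le p 2
  have he2 : e ^ 2 = e * e := sq e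
  by_cases hsq : r * r = p / 2
  · -- `e ≤ 4r + 4`: `e² ≤ 16 r² + 32 r + 16 ≤ 8p + 32r + 16 ≤ 9p`
    have h32 : 32 * r + 24 ≤ p := by
      rcases Nat.lt_or_ge r 25 with h25 | h25
      · omega
      · have : 25 * r ≤ r * r := Nat.mul_le_mul_right r h25
        omega
    have hee : e * e ≤ (4 * r + 4) * (4 * r + 4) := Nat.mul_le_mul hele hele
    nlinarith [hee, hrr, hX2, h32]
  · have he := hesmall hsq
    have hee : e * e ≤ (2 * r + 2) * (2 * r + 2) := Nat.mul_le_mul he he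
    have hrp : r ≤ p / 2 := hr ▸ Nat.sqrt_le_self (p / 2)
    nlinarith [hee, hrr, hX2, hrp]

/-! ## §3 The `(3,−)` pin from `u² + 2v² − 2w² = p`, `p ≡ 3 (mod 8)` -/

/-- **The `(3,−)` certificate.** For a prime `p ≡ 3 (mod 8)`, `p ≥ 11`, there are `u v w q : ℕ` with `u² + 2v² = p + 2w²`,
`u, v` odd, `0 < w < p`, `q` a prime `≡ 3 (mod 8)` dividing `p + 2w²`, `(q/p) = −1`, and `u ≤ ⌊√(p+5)⌋ + 2`,
`4v + p + 2 = u²` (so `w = v + 1 ≤ √(p+5) + 3`). Construction: `u` the least odd number with `u² ≥ p + 6`,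
`v = (u² − p − 2)/4`, `w = v + 1`. [folklore] -/
theorem exists_indefinite_certificate_threeMinus {p : ℕ} (hp : p.Prime) (hp8 : p % 8 = 3) (hp11 : 11 ≤ p) :
    ∃ u v w q : ℕ, u ^ 2 + 2 * v ^ 2 = p + 2 * w ^ 2 ∧ u % 2 = 1 ∧ v % 2 = 1 ∧ 0 < w ∧ w < p ∧
      q.Prime ∧ q ∣ p + 2 * w ^ 2 ∧ q % 8 = 3 ∧ jacobiSym (q : ℤ) p = -1 ∧
      u ≤ Nat.sqrt (p + 5) + 2 ∧ 4 * v + p + 2 = u ^ 2 ∧ w = v + 1 := by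
  set r := Nat.sqrt (p + 5) with hr
  have hrr : r * r ≤ p + 5 := Nat.sqrt_le (p + 5)
  have hpr : p + 5 < (r + 1) * (r + 1) := Nat.lt_succ_sqrt (p + 5)
  -- `u` odd with `(r+1) ≤ u ≤ r + 2`
  obtain ⟨u, hu2, hru, hur⟩ : ∃ u : ℕ, u % 2 = 1 ∧ r + 1 ≤ u ∧ u ≤ r + 2 := by
    by_cases hodd : r % 2 = 1
    · exact ⟨r + 2, by omega, by omega, le_rfl⟩
    · exact ⟨r + 1, by omega, le_rfl, by omega⟩
  have hu6 : p + 6 ≤ u ^ 2 := by nlinarith [Nat.mul_le_mul hru hru]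
  have hu8' : u ^ 2 % 8 = 1 := sq_mod_eight_of_odd hu2
  -- `v = (u² - p - 2)/4` is odd
  obtain ⟨v, hv⟩ : ∃ v : ℕ, 4 * v + p + 2 = u ^ 2 := ⟨(u ^ 2 - p - 2) / 4, by omega⟩
  have hv2 : v % 2 = 1 := by omega
  have hv8 : v ^ 2 % 8 = 1 := sq_mod_eight_of_odd hv2
  set w := v + 1 with hw
  have hid : u ^ 2 + 2 * v ^ 2 = p + 2 * w ^ 2 := by
    rw [hw]
    nlinarith [hv]
  have hB3 : (u ^ 2 + 2 * v ^ 2) % 8 = 3 := by omega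
  obtain ⟨q, hq, hqB, hq8⟩ := exists_prime_dvd_mod_eight_eq_three (m := u ^ 2 + 2 * v ^ 2) rfl hB3
  rw [hid] at hqB
  -- `w < p`: `4v ≤ u² - p - 2 ≤ (r+2)² - p - 2 ≤ 4r + 7`, so `v ≤ r + 1`, `w ≤ r + 2 < p`
  have hv_le : v ≤ r + 1 := by nlinarith [Nat.mul_le_mul hur hur, hrr, hv]
  have hrp : r + 3 ≤ p := by nlinarith [hrr]
  have hwp : w < p := by omega
  have hw0 : 0 < w := by omega
  -- `q ∤ w`
  have hqw : ¬ q ∣ w := by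
    intro hqw'
    have hqp : q ∣ p := by
      have h1 : q ∣ 2 * w ^ 2 := Dvd.dvd.mul_left (Dvd.dvd.pow hqw' two_ne_zero) 2
      exact (Nat.dvd_add_right h1).mp (by rwa [add_comm] at hqB)
    have hqp' : q = p := (Nat.prime_dvd_prime_iff_eq hq hp).mp hqp
    rw [hqp'] at hqw'
    exact absurd (Nat.le_of_dvd hw0 hqw') (by omega)
  exact ⟨u, v, w, q, hid, hu2, hv2, hw0, hwp, hq, hqB, hq8,
    jacobiSym_eq_neg_one_of_two_mul_sq_add_dvd hq (by omega) hq8 hqw hqB, hur, hv, rfl⟩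

/-- **The `(3,−)` pin for `p ≡ 3 (mod 8)`, sized** (consumer form; the `p ≡ 3 (mod 8)` twin of p643125's
`ternaryPinThreeMinus_of_mod_eight_eq_seven`, with `4p` in place of `p`): for a prime `p ≡ 3 (mod 8)`, `p ≥ 200`,
there is a prime `q ≡ 3 (mod 8)` with `(q/p) = −1` and `q ≤ 4p`. [folklore] -/
theorem indefinitePinThreeMinus_of_mod_eight_eq_three {p : ℕ} (hp : p.Prime) (hp8 : p % 8 = 3) (h200 : 200 ≤ p) :
    ∃ q : ℕ, q.Prime ∧ q % 8 = 3 ∧ jacobiSym (q : ℤ) p = -1 ∧ q ≤ 4 * p := by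
  obtain ⟨u, v, w, q, -, -, -, -, -, hq, hqB, hq8, hJ, hur, hv, hw⟩ :=
    exists_indefinite_certificate_threeMinus hp hp8 (by omega)
  refine ⟨q, hq, hq8, hJ, (Nat.le_of_dvd (by positivity) hqB).trans ?_⟩
  obtain ⟨r, hr⟩ : ∃ r, r = Nat.sqrt (p + 5) := ⟨_, rfl⟩
  rw [← hr] at hur
  have hrr : r * r ≤ p + 5 := hr ▸ Nat.sqrt_le (p + 5)
  -- linearisation `28 r ≤ r² + 196 ≤ p + 201`
  have hlin : 28 * r ≤ p + 201 := by nlinarith [hrr]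
  have huu : u ^ 2 ≤ (r + 2) * (r + 2) := by rw [sq]; exact Nat.mul_le_mul hur hur
  have hw3 : w ≤ r + 3 := by
    rw [hw]
    nlinarith [huu, hrr, hv]
  have hww : w ^ 2 ≤ (r + 3) * (r + 3) := by rw [sq]; exact Nat.mul_le_mul hw3 hw3
  nlinarith [hww, hrr, hlin]

end Summit.BirchSwinnertonDyer.BirchSwinnertonDyer.Theorems.BiquadraticEisensteinDescentHeegnerTwistCouplingInSupplyIndefinitePin
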